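import Summits.AnomalousDissipation.AnomalousDissipation.Theses.TaylorCertificates
import Summits.AnomalousDissipation.AnomalousDissipation.Theorems.TaylorCertificatePair.Negative.Modes
import Literature.Analysis.FunctionSpaces.TorusFluidGlueProofs
import Literature.Analysis.FunctionSpaces.TorusLerayHelmholtzProofs
import Literature.Analysis.FunctionSpaces.TorusCalculusProofs
import Literature.Analysis.FunctionSpaces.TorusTestFunction
import Literature.Analysis.FluidPDE.OnsagerBDSVGluing
import Summits.AnomalousDissipation.AnomalousDissipation.Theorems.TaylorCertificatesSmoothEulerCoerciveForceStubWorkIdentity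
import Summits.AnomalousDissipation.AnomalousDissipation.Theorems.TaylorCertificatesSmoothEulerCoerciveForceStubStrongForm
import Summits.AnomalousDissipation.AnomalousDissipation.Theorems.TaylorCertificatesSmoothEulerCoerciveForceStubHeadTransport
import Summits.AnomalousDissipation.AnomalousDissipation.Theorems.TaylorCertificatesSmoothEulerCoerciveForceStubLambForm
import Summits.AnomalousDissipation.AnomalousDissipation.Theorems.TaylorCertificatesSmoothEulerCoerciveForceStubVorticityTransport

/-!
# Skeleton of the line `Sketch` (helical glue path) for the crux
# `TaylorCertificates.SmoothEulerCoerciveForce` (stmt-AnomalousDissipation-14097)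

Line lead `prover-line-stmt-AnomalousDissipation-14097-0`.  The crux asks for ONE smooth divergence-free
mean-zero force `f` on `T³` with no smooth divergence-free mean-zero quiet Euler point
(`P[(v·∇)v] = f`).  The line bets on the helical Kolmogorov (Reeb/ABC) force
`b = (sin 2πx₃, cos 2πx₃, 0)` (`|b| ≡ 1`, `curl b = 2πb`), written INLINE as the real mode
`Torus.realTrigPoly {![0,0,1]} (fun _ => WithLp.toLp 2 ![-Complex.I, 1, 0])` so that every stub is def-free.

Composition `SmoothEulerCoerciveForce_of`: `b` is admissible (smooth / div-free / mean-zero, proved here from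
the tree's mode API); a quiet point `v` of `b` has a smooth pressure (`stub_strongForm`: weak ⇒ strong form,
general force), does no work against the force (`stub_workIdentity`, general force), transports its Bernoulli
head at the rate `⟪f, v⟫` (`stub_headTransport`, general force), satisfies the Lamb identity
`(v·∇)v = curl v × v + ∇(|v|²/2)` (`stub_lambForm`, pure calculus) and the steady vorticity equation
`(v·∇)ω − (ω·∇)v = curl b = 2πb` (`stub_vorticityTransport`), and the residual `stub_helicalCore` says no
smooth divergence-free mean-zero `(v, p)` solves `(v·∇)v + ∇p = b` given those four laws.  The first five
stubs are provable now over the tree (`Torus.integral_inner_convect_eq_neg`, `Torus.smooth_helmholtz_holds`,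
chain/product rules for `Torus.fderiv`/`Torus.partialDeriv`, symmetry of second torus derivatives,
`IntermittentBeltrami.curl_realTrigPoly`); the sixth is the line's bet (card `helical-reeb-force`).
-/

-- `Summit.<Summit>.<Problem>` is the tree's mandated summit-side namespace (CONVENTIONS §2); for this
-- single-conjunct summit the two coincide, so the duplicate is deliberate.
set_option linter.dupNamespace false

noncomputable section

open MeasureTheory
open scoped InnerProductSpace

namespace Summit.AnomalousDissipation.AnomalousDissipation.Theorems.SmoothEulerCoerciveForce.Helical

open Literature.Analysis.FunctionSpaces
open Summit.AnomalousDissipation.AnomalousDissipation.Theorems.TaylorCertificatePair.Negative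

/-! ## Registered stubs

Stubs 1–5 are LANDED (kernel-checked, `--supports stmt-AnomalousDissipation-14097`) and imported:
`stub_workIdentity` (p86077, …StubWorkIdentity.lean), `stub_strongForm` (p89280, …StubStrongForm.lean),
`stub_headTransport` (p86207, …StubHeadTransport.lean), `stub_lambForm` (p86199, …StubLambForm.lean),
`stub_vorticityTransport` (p87962, …StubVorticityTransport.lean).  Only the core stub below is open. -/

/-- **Stub 6 (the helical core; the line's bet).** No smooth divergence-free mean-zero `v` with a smooth
pressure `p` solves the steady Euler equations forced by the helical Kolmogorov force
`b = (sin 2πx₃, cos 2πx₃, 0)` — given, for free, the exact laws every such solution obeys (zero work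
`∫⟪b, v⟫ = 0`, head transport `DH[v] = ⟪b, v⟫`, the Lamb form of the inertial term, and the steady
vorticity equation `(v·∇)ω − (ω·∇)v = 2πb`).  Card `helical-reeb-force`: fluctuation annihilation +
helical mean momentum flux; 2½-D solutions collapse onto the mean-zero planar Kolmogorov problem. -/
theorem stub_helicalCore
    (v : UnitAddTorus (Fin 3) → EuclideanSpace ℝ (Fin 3)) (p : UnitAddTorus (Fin 3) → ℝ)
    (hvs : Torus.IsSmooth v) (hvd : Torus.IsDivFree v) (hvz : Torus.HasZeroMean v) (hp : Torus.IsSmooth p)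
    (he : ∀ x, Torus.convect v v x + Torus.gradient p x =
      Torus.realTrigPoly {![0, 0, 1]} (fun _ => WithLp.toLp 2 ![-Complex.I, 1, 0]) x)
    (hwork : ∫ x, inner ℝ (Torus.realTrigPoly {![0, 0, 1]} (fun _ => WithLp.toLp 2 ![-Complex.I, 1, 0]) x)
      (v x) = 0)
    (hhead : ∀ x, Torus.fderiv (fun y => p y + ‖v y‖ ^ 2 / 2) x (v x) =
      inner ℝ (Torus.realTrigPoly {![0, 0, 1]} (fun _ => WithLp.toLp 2 ![-Complex.I, 1, 0]) x) (v x))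
    (hlamb : ∀ x, Torus.convect v v x =
      WithLp.toLp 2 (crossProduct (WithLp.ofLp (Literature.Analysis.FluidPDE.BDSV.curl v x))
        (WithLp.ofLp (v x))) + Torus.gradient (fun y => ‖v y‖ ^ 2 / 2) x)
    (hvort : ∀ x, Torus.convect v (Literature.Analysis.FluidPDE.BDSV.curl v) x -
        Torus.convect (Literature.Analysis.FluidPDE.BDSV.curl v) v x =
      (2 * Real.pi) • Torus.realTrigPoly {![0, 0, 1]} (fun _ => WithLp.toLp 2 ![-Complex.I, 1, 0]) x) :
    False := by
  sorry

/-! ## The force is admissible (proved) -/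

/-- The vertical frequency `e₃ = (0,0,1)` is nonzero. -/
theorem e3_ne_zero : (![0, 0, 1] : Fin 3 → ℤ) ≠ 0 := by
  intro h
  have := congrFun h 2
  simp at this

/-- The helical polarisation `(−i, 1, 0)` is transversal to `e₃`. -/
theorem helical_transversal :
    ((fun j => (((![0, 0, 1] : Fin 3 → ℤ)) j : ℂ)) ⬝ᵥ
      (WithLp.ofLp (WithLp.toLp 2 ![-Complex.I, 1, 0] : EuclideanSpace ℂ (Fin 3)))) = 0 := by
  simp [dotProduct, Fin.sum_univ_three]

/-- The helical force `b = (sin 2πx₃, cos 2πx₃, 0)` is smooth. -/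
theorem isSmooth_helical :
    Torus.IsSmooth (Torus.realTrigPoly {![0, 0, 1]} (fun _ => WithLp.toLp 2 ![-Complex.I, 1, 0]) :
      UnitAddTorus (Fin 3) → EuclideanSpace ℝ (Fin 3)) :=
  isSmooth_mode _ _

/-- The helical force is divergence free. -/
theorem isDivFree_helical :
    Torus.IsDivFree (Torus.realTrigPoly {![0, 0, 1]} (fun _ => WithLp.toLp 2 ![-Complex.I, 1, 0]) :
      UnitAddTorus (Fin 3) → EuclideanSpace ℝ (Fin 3)) :=
  Torus.isDivFree_realTrigPoly_singleton helical_transversal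

/-- The helical force has zero mean. -/
theorem hasZeroMean_helical :
    Torus.HasZeroMean (Torus.realTrigPoly {![0, 0, 1]} (fun _ => WithLp.toLp 2 ![-Complex.I, 1, 0]) :
      UnitAddTorus (Fin 3) → EuclideanSpace ℝ (Fin 3)) :=
  hasZeroMean_mode e3_ne_zero _

/-! ## Composition -/

/-- **Composition.** The six registered stubs close the crux with the helical force as witness.  NOTE
(2026-08-16T08:40Z): route rev 13 (06:39:58Z) DROPPED the decl `Theses.TaylorCertificates.SmoothEulerCoerciveForce`
and closed item stmt-AnomalousDissipation-14097 as `moot` (wanted_by = []), so the conclusion is spelled out here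
VERBATIM as the item's signature instead of the (no longer existing) route decl name; if the crux is re-attached to a
route with the same statement, `theorem SmoothEulerCoerciveForce_of : <RouteDecl> := smoothEulerCoerciveForce_of_stubs`
closes it by `Iff.rfl`-free definitional unfolding. -/
theorem smoothEulerCoerciveForce_of_stubs :
    ∃ f : UnitAddTorus (Fin 3) → EuclideanSpace ℝ (Fin 3), Literature.Analysis.FunctionSpaces.Torus.IsSmooth f ∧
      Literature.Analysis.FunctionSpaces.Torus.IsDivFree f ∧ Literature.Analysis.FunctionSpaces.Torus.HasZeroMean f ∧
      ∀ v : UnitAddTorus (Fin 3) → EuclideanSpace ℝ (Fin 3), Literature.Analysis.FunctionSpaces.Torus.IsSmooth v →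
        Literature.Analysis.FunctionSpaces.Torus.IsDivFree v → Literature.Analysis.FunctionSpaces.Torus.HasZeroMean v →
        (∀ w : UnitAddTorus (Fin 3) → EuclideanSpace ℝ (Fin 3), Literature.Analysis.FunctionSpaces.Torus.IsSmooth w →
          Literature.Analysis.FunctionSpaces.Torus.IsDivFree w → Literature.Analysis.FunctionSpaces.Torus.HasZeroMean w →
          ∫ x, inner ℝ (Literature.Analysis.FunctionSpaces.Torus.convect v v x - f x) (w x) = 0) → False := by
  refine ⟨Torus.realTrigPoly {![0, 0, 1]} (fun _ => WithLp.toLp 2 ![-Complex.I, 1, 0]),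
    isSmooth_helical, isDivFree_helical, hasZeroMean_helical, ?_⟩
  intro v hvs hvd hvz hq
  obtain ⟨p, hp, he⟩ := stub_strongForm _ v isSmooth_helical hasZeroMean_helical hvs hvd hq
  exact stub_helicalCore v p hvs hvd hvz hp he
    (stub_workIdentity _ v isSmooth_helical hvs hvd hvz hq)
    (stub_headTransport _ v p hvs hp he) (stub_lambForm v hvs)
    (stub_vorticityTransport v p hvs hvd hp he)

end Summit.AnomalousDissipation.AnomalousDissipation.Theorems.SmoothEulerCoerciveForce.Helical

end
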